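import Literature.Computability.Cryptography.LWESwitchRowProg
import Literature.Computability.Cryptography.LWESwitchKernelProgLaw
import HarnessLib

/-!
# The h₃ machine's row and reference-block programs on uniform coins have the laws `machRowPMF` and the residue reference law

Topic `Computability/Cryptography` (LWE), grouping namespace `BLPRS2013.KProg`; sequel of `LWESwitchRowProg.lean` (the programs `rowFlat`,
`refFlat`) and `LWESwitchKernelProgLaw.lean` (`uniformVector_map_kernelFlat`: ONE switched sample on uniform coins samples `machSamplePMF`).
On a uniform coin string long enough, the row program samples `machRowPMF` of `LWESwitchMachineKernel.lean` (shift `t` from residues, then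
the samples independently), and the reference-block program samples `m` independent machine-"uniform" samples (residues), both read
through `LWE.MP12.Prog.toItem`. Everything PROVED; two small definitions with bodies (`shiftOfCoins`, `refLaw`); no named fact.

* `tFlat_append_left`, `tFlat_eq_encT`, **`uniformVector_map_shift`** (the shift read off uniform coins is `iidPMF (modLaw 2ᴸ q) n`);
* **`uniformVector_map_rowFlat`** — `(U {0,1}^{C₀}).map (rowFlat … (items of S)) = (machRowPMF … 2ᴸ m S).map (items)` for `C₀ ≥ nL + m·C₁`;
* `refLaw q L n` (one reference sample: `(iidPMF (modLaw 2ᴸ q) n, modLaw 2ᴸ q)`), **`uniformVector_map_refFlat`** —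
  `(U {0,1}^{C₀}).map (refFlat q L n m) = (iidPMF (refLaw q L n) m).map (items)` for `C₀ ≥ m(n+1)L`.

## References

* Z. Brakerski, A. Langlois, C. Peikert, O. Regev, D. Stehlé, *Classical hardness of learning with errors*, STOC 2013;
  arXiv:1306.0281, Cor. 3.2 with Lemma 2.15 and §5. [BrakerskiEtAl2013]
* O. Regev, *On lattices, learning with errors …*, J. ACM 56 (2009), Lemma 4.1 (proof: the uniform shift from coins). [RegevLWE2009]
* S. Arora, B. Barak, *Computational Complexity: A Modern Approach*, CUP 2009, Def. 7.1. [AroraBarak2009]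
-/

noncomputable section

open scoped ENNReal
open PMF Literature.Probability.Distributions Literature.Algebra.EuclideanLattices Literature.Computability.Complexity

namespace Literature.Computability.Cryptography

namespace BLPRS2013

namespace KProg

open GaussRejMachine LWE LWE.MP12 LWE.MP12.Prog

/-! ### The shift read off the coins -/

section Shift

variable (q L n : ℕ)

/-- The shift read off uniform words: `tⱼ = (value of word j) mod q`. [cite: RegevLWE2009, Lemma 4.1 (proof)] -/
def shiftOfCoins {C : ℕ} (h : L * n ≤ C) (v : List.Vector Bool C) : Fin n → ZMod q :=
  fun j => (((vecNum (chunks L n h v j)).val : ℕ) : ZMod q)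

variable {q L n}

/-- The shift program reads only the first `nL` coins. [folklore] -/
theorem tFlat_append_left {l₁ : List Bool} (l₂ : List Bool) (h : n * L ≤ l₁.length) : tFlat q L n (l₁ ++ l₂) = tFlat q L n l₁ := by
  unfold tFlat
  refine List.map_congr_left fun j hj => ?_
  rw [List.mem_range] at hj
  have h1 : j * L + L ≤ l₁.length := by nlinarith
  rw [List.drop_append_of_le_length (by omega), List.take_append_of_le_length (by rw [List.length_drop]; omega)]

/-- **The shift program outputs `encT` of `shiftOfCoins`** (`q ≥ 1`). [folklore] -/
theorem tFlat_eq_encT [NeZero q] {C : ℕ} (h : L * n ≤ C) (v : List.Vector Bool C) :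
    tFlat q L n v.toList = encT (shiftOfCoins q L n h v) := by
  unfold tFlat encT shiftOfCoins
  rw [show ((List.range n).map fun j => bitsToNat ((v.toList.drop (j * L)).take L) % q) =
      ((List.range n).map fun j => (v.toList.drop (j * L)).take L).map (fun ch => bitsToNat ch % q) by rw [List.map_map]; rfl,
    chunkList_eq_ofFn, List.map_ofFn]
  congr 1
  funext j
  simp [ZMod.val_natCast, chunks]

/-- **The shift read off uniform coins is `iidPMF (modLaw 2ᴸ q) n`.** [cite: RegevLWE2009, Lemma 4.1 (proof); AroraBarak2009, Def. 7.1] -/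
theorem uniformVector_map_shift [NeZero q] {C : ℕ} (h : L * n ≤ C) :
    (uniformOfFintype (List.Vector Bool C)).map (shiftOfCoins q L n h) = iidPMF (modLaw (2 ^ L) q) n := by
  have hfac : shiftOfCoins q L n h = (fun c j => (((vecNum (c j)).val : ℕ) : ZMod q)) ∘ chunks L n h := by
    funext v; rfl
  rw [hfac, ← PMF.map_comp, uniformVector_map_chunks_eq_indepLaw,
    indepLaw_map_pi n _ (fun _ (c : List.Vector Bool L) => (((vecNum c).val : ℕ) : ZMod q)), ← indepLaw_const]
  congr 1
  funext j
  rw [modLaw, ← PMF.uniformOfFintype_map_equiv (Equiv.ofBijective _ (vecNum_bijective L)), PMF.map_comp]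
  rfl

end Shift

/-! ### The row program samples `machRowPMF` -/

section Row

variable {n Q q' : ℕ} [NeZero Q] [NeZero q'] (θ : ℚ) (s N Pr w R : ℕ) (κh : ℚ) (b P : ℕ) (PG : PGParams) (L : ℕ) {m : ℕ}

/-- **On uniform coins the row program samples `machRowPMF`** (residue modulus `2ᴸ`), read through `toItem`, for coin strings of length
`C₀ ≥ nL + m·C₁`, `C₁ = nC + P + coinLen`. [cite: BrakerskiEtAl2013, Cor. 3.2 with Lemma 2.15 and §5; RegevLWE2009, Lemma 4.1 (proof)] -/
theorem uniformVector_map_rowFlat (S : Fin m → (Fin n → ZMod Q) × ZMod Q) {C₀ : ℕ}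
    (hC₀ : n * L + m * sampleWidth n Pr w R P PG ≤ C₀) :
    (uniformOfFintype (List.Vector Bool C₀)).map (fun v =>
      rowFlat θ s N Pr w R q' Q κh b P PG L n (List.ofFn fun i => toItem (S i)) v.toList) =
      (machRowPMF n Q q' θ s N Pr w R κh b P PG.lawPMF (2 ^ L) m S).map fun y => List.ofFn fun i => toItem (y i) := by
  classical
  set C₁ := sampleWidth n Pr w R P PG with hC₁def
  have h1 : n * L ≤ C₀ := by
    have := Nat.zero_le (m * C₁); omega
  have hLn : L * n ≤ n * L := le_of_eq (Nat.mul_comm L n)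
  -- the shift from the first `nL` coins, the samples from the rest
  set tOfV : List.Vector Bool (n * L) → (Fin n → ZMod q') := shiftOfCoins q' L n hLn with htOfV
  set smp : (Fin n → ZMod q') → List.Vector Bool (C₀ - n * L) → List (List ℕ × ℕ) := fun t v₂ =>
    List.ofFn fun i => kernelFlat θ s N Pr w R q' Q κh b P PG (encT t) (List.ofFn fun j => ((S i).1 j).val) (S i).2.val (chunk C₁ v₂.toList i)
    with hsmp
  have hfac : (fun v : List.Vector Bool C₀ => rowFlat θ s N Pr w R q' Q κh b P PG L n (List.ofFn fun i => toItem (S i)) v.toList) =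
      (fun pr : List.Vector Bool (n * L) × List.Vector Bool (C₀ - n * L) => smp (tOfV pr.1) pr.2) ∘ vecSplit (n * L) C₀ h1 := by
    funext v
    simp only [Function.comp_apply, vecSplit, Equiv.coe_fn_mk, hsmp, htOfV]
    unfold rowFlat
    simp only [List.length_ofFn, chunkList_eq_ofFn, zipWith_ofFn_ofFn]
    have ht : tFlat q' L n v.toList = encT (shiftOfCoins q' L n hLn ⟨v.toList.take (n * L), by simp [h1]⟩) := by
      rw [← tFlat_eq_encT]
      conv_lhs => rw [← List.take_append_drop (n * L) v.toList]
      rw [tFlat_append_left _ (by rw [List.length_take, List.Vector.toList_length, min_eq_left h1])]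
      rfl
    rw [ht]
    rfl
  rw [hfac, ← PMF.map_comp, uniformVector_map_vecSplit, uniformOfFintype_prod_eq_bind, PMF.map_bind]
  simp only [PMF.map_comp, Function.comp_def]
  -- the law of the samples given the shift
  have hsmpLaw : ∀ t : Fin n → ZMod q', (uniformOfFintype (List.Vector Bool (C₀ - n * L))).map (smp t) =
      (indepLaw m fun i => (machSamplePMF n Q q' θ s N Pr w R κh b P PG.lawPMF t (S i)).map (toItem (d := n) (Q := q'))).map List.ofFn := by
    intro t
    have hm : C₁ * m ≤ C₀ - n * L := by rw [Nat.mul_comm]; omega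
    have hf : smp t = List.ofFn ∘ (fun c i => kernelFlat θ s N Pr w R q' Q κh b P PG (encT t) (List.ofFn fun j => ((S i).1 j).val) (S i).2.val
        (c i).toList) ∘ chunks C₁ m hm := by
      funext v₂; rfl
    rw [hf, ← PMF.map_comp, ← PMF.map_comp, uniformVector_map_chunks_eq_indepLaw,
      indepLaw_map_pi m _ (fun i (c : List.Vector Bool C₁) =>
        kernelFlat θ s N Pr w R q' Q κh b P PG (encT t) (List.ofFn fun j => ((S i).1 j).val) (S i).2.val c.toList)]
    congr 2
    funext i
    exact uniformVector_map_kernelFlat θ s N Pr w R κh b P PG t (S i) le_rfl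
  -- assemble
  calc ((uniformOfFintype (List.Vector Bool (n * L))).bind fun v₁ =>
        (uniformOfFintype (List.Vector Bool (C₀ - n * L))).map fun v₂ => smp (tOfV v₁) v₂)
      = (uniformOfFintype (List.Vector Bool (n * L))).bind fun v₁ =>
          (uniformOfFintype (List.Vector Bool (C₀ - n * L))).map (smp (tOfV v₁)) := rfl
    _ = ((uniformOfFintype (List.Vector Bool (n * L))).map tOfV).bind fun t =>
          (uniformOfFintype (List.Vector Bool (C₀ - n * L))).map (smp t) := by rw [PMF.bind_map]; rfl
    _ = (iidPMF (modLaw (2 ^ L) q') n).bind fun t =>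
          (indepLaw m fun i => (machSamplePMF n Q q' θ s N Pr w R κh b P PG.lawPMF t (S i)).map (toItem (d := n) (Q := q'))).map List.ofFn := by
        rw [htOfV, uniformVector_map_shift]
        congr 1
        funext t
        exact hsmpLaw t
    _ = (machRowPMF n Q q' θ s N Pr w R κh b P PG.lawPMF (2 ^ L) m S).map fun y => List.ofFn fun i => toItem (y i) := by
        rw [machRowPMF, PMF.map_bind]
        congr 1
        funext t
        rw [← indepLaw_eq_piLaw, show (fun y : Fin m → (Fin n → ZMod q') × ZMod q' => List.ofFn fun i => toItem (d := n) (Q := q') (y i)) =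
          List.ofFn ∘ (fun y i => toItem (d := n) (Q := q') (y i)) from rfl, ← PMF.map_comp,
          indepLaw_map_pi m _ (fun _ => toItem (d := n) (Q := q'))]

end Row

/-! ### The reference-block program samples independent residue samples -/

section Ref

variable (q L n : ℕ) [NeZero q]

/-- **The law of ONE machine reference sample**: `n` residues for `a`, one for `b`. [cite: RegevLWE2009, Lemma 4.1 (proof)] -/
def refLaw : PMF ((Fin n → ZMod q) × ZMod q) :=
  prodLaw (iidPMF (modLaw (2 ^ L) q) n) (modLaw (2 ^ L) q)

variable {q L n}

/-- One reference item read off a word of `(n+1)L` coins is `toItem` of a `refLaw` sample, in law. [folklore] -/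
theorem uniformVector_map_refItem :
    (uniformOfFintype (List.Vector Bool ((n + 1) * L))).map (fun ci : List.Vector Bool ((n + 1) * L) =>
      ((tFlat q L n ci.toList), bitsToNat ((ci.toList.drop (n * L)).take L) % q)) =
      (refLaw q L n).map (toItem (d := n) (Q := q)) := by
  classical
  have h1 : n * L ≤ (n + 1) * L := by nlinarith
  have hLn : L * n ≤ n * L := le_of_eq (Nat.mul_comm L n)
  have hL1 : L * 1 ≤ (n + 1) * L - n * L := by
    rw [Nat.succ_mul, Nat.add_sub_cancel_left]; omega
  have hfac : (fun ci : List.Vector Bool ((n + 1) * L) => ((tFlat q L n ci.toList), bitsToNat ((ci.toList.drop (n * L)).take L) % q)) =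
      (fun pr : List.Vector Bool (n * L) × List.Vector Bool ((n + 1) * L - n * L) =>
        (encT (shiftOfCoins q L n hLn pr.1), ((shiftOfCoins q L 1 hL1 pr.2) 0).val)) ∘ vecSplit (n * L) ((n + 1) * L) h1 := by
    funext ci
    simp only [Function.comp_apply, vecSplit, Equiv.coe_fn_mk]
    refine Prod.ext ?_ ?_
    · rw [← tFlat_eq_encT]
      conv_lhs => rw [← List.take_append_drop (n * L) ci.toList]
      rw [tFlat_append_left _ (by rw [List.length_take, List.Vector.toList_length, min_eq_left h1])]
      rfl
    · simp [shiftOfCoins, chunks, chunk, ZMod.val_natCast]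
  rw [hfac, ← PMF.map_comp, uniformVector_map_vecSplit, uniformOfFintype_prod_eq_bind, PMF.map_bind]
  simp only [PMF.map_comp, Function.comp_def]
  rw [refLaw, prodLaw, PMF.map_bind]
  have hb : (uniformOfFintype (List.Vector Bool ((n + 1) * L - n * L))).map (fun v => ((shiftOfCoins q L 1 hL1 v) 0).val) =
      (modLaw (2 ^ L) q).map ZMod.val := by
    rw [show (fun v : List.Vector Bool ((n + 1) * L - n * L) => ((shiftOfCoins q L 1 hL1 v) 0).val) =
        (fun u : Fin (2 ^ L) => (((u.val : ℕ) : ZMod q)).val) ∘ (vecNum : List.Vector Bool L → Fin (2 ^ L)) ∘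
          (fun c : Fin 1 → List.Vector Bool L => c 0) ∘ chunks L 1 hL1 from rfl,
      ← PMF.map_comp, ← PMF.map_comp, ← PMF.map_comp, uniformVector_map_chunks_eq_indepLaw, indepLaw_eq_piLaw, piLaw_map_eval,
      show (vecNum : List.Vector Bool L → Fin (2 ^ L)) = ⇑(Equiv.ofBijective _ (vecNum_bijective L)) from rfl,
      PMF.uniformOfFintype_map_equiv, modLaw, PMF.map_comp]
    rfl
  calc ((uniformOfFintype (List.Vector Bool (n * L))).bind fun v₁ =>
        (uniformOfFintype (List.Vector Bool ((n + 1) * L - n * L))).map fun v₂ =>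
          (encT (shiftOfCoins q L n hLn v₁), ((shiftOfCoins q L 1 hL1 v₂) 0).val))
      = ((uniformOfFintype (List.Vector Bool (n * L))).map (shiftOfCoins q L n hLn)).bind fun t =>
          ((uniformOfFintype (List.Vector Bool ((n + 1) * L - n * L))).map fun v => ((shiftOfCoins q L 1 hL1 v) 0).val).map
            fun bv => (encT t, bv) := by
        rw [PMF.bind_map]
        simp only [PMF.map_comp, Function.comp_def]
    _ = (iidPMF (modLaw (2 ^ L) q) n).bind fun t => (modLaw (2 ^ L) q).map fun bb => toItem (d := n) (Q := q) (t, bb) := by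
        rw [uniformVector_map_shift, hb]
        congr 1
        funext t
        rw [PMF.map_comp]
        rfl
    _ = _ := by
        simp only [PMF.map_comp, Function.comp_def]

/-- **On uniform coins the reference-block program samples `m` independent reference samples** (read through `toItem`), for coin strings
of length `C₀ ≥ m(n+1)L`. [cite: BrakerskiEtAl2013, Lemma 2.15 (proof sketch); RegevLWE2009, Lemma 4.1 (proof); AroraBarak2009, Def. 7.1] -/
theorem uniformVector_map_refFlat (m : ℕ) {C₀ : ℕ} (hC₀ : m * ((n + 1) * L) ≤ C₀) :
    (uniformOfFintype (List.Vector Bool C₀)).map (fun v => refFlat q L n m v.toList) =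
      (iidPMF (refLaw q L n) m).map fun y => List.ofFn fun i => toItem (y i) := by
  classical
  have hm : (n + 1) * L * m ≤ C₀ := by rw [Nat.mul_comm]; exact hC₀
  have hfac : (fun v : List.Vector Bool C₀ => refFlat q L n m v.toList) =
      List.ofFn ∘ (fun c (i : Fin m) => ((tFlat q L n (c i).toList), bitsToNat (((c i).toList.drop (n * L)).take L) % q)) ∘
        chunks ((n + 1) * L) m hm := by
    funext v
    simp only [Function.comp_apply]
    unfold refFlat
    rw [show (fun i => (tFlat q L n ((v.toList.drop (i * ((n + 1) * L))).take ((n + 1) * L)),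
          bitsToNat ((((v.toList.drop (i * ((n + 1) * L))).take ((n + 1) * L)).drop (n * L)).take L) % q)) =
        (fun ci : List Bool => (tFlat q L n ci, bitsToNat ((ci.drop (n * L)).take L) % q)) ∘
          (fun i => (v.toList.drop (i * ((n + 1) * L))).take ((n + 1) * L)) from rfl,
      ← List.map_map, chunkList_eq_ofFn, List.map_ofFn]
    rfl
  rw [hfac, ← PMF.map_comp, ← PMF.map_comp, uniformVector_map_chunks_eq_indepLaw,
    indepLaw_map_pi m _ (fun _ (ci : List.Vector Bool ((n + 1) * L)) => ((tFlat q L n ci.toList), bitsToNat ((ci.toList.drop (n * L)).take L) % q)),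
    show (fun y : Fin m → (Fin n → ZMod q) × ZMod q => List.ofFn fun i => toItem (d := n) (Q := q) (y i)) =
      List.ofFn ∘ (fun y i => toItem (d := n) (Q := q) (y i)) from rfl, ← PMF.map_comp, iidPMF_eq_indepLaw,
    indepLaw_map_pi m _ (fun _ => toItem (d := n) (Q := q))]
  congr 2
  funext i
  exact uniformVector_map_refItem

end Ref

end KProg

end BLPRS2013

end Literature.Computability.Cryptography

end
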